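import Literature.MathematicalPhysics.StatisticalMechanics.BarlowCoordination
import Literature.Probability.Process.RootedHardCoreConfig

/-!
# `StackingHinge` (stmt-AtomisticToContinuum-14993), line `Sketch`: stub `stub_singleOccupancy`

NO MICRO-CLUSTERS. Let `S ⊆ ℝ³` be `δ`-separated, all of whose points are SLP-good (two-way
`t`-matched with a rigidly moved ideal Barlow stacking at the point's own nearest-neighbour scale,
for every precision `t > nn/6` and radius `r < 3 nn`) and bond-shell-good. Fix `x ∈ S` with
scale `nn = Metric.infDist x (S \ {x})`, a precision `t ∈ (nn/6, 7nn/40]`, a radius `r ≥ 29nn/10`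
and matching data `(s, g)`. Then every pattern point `g z` with `dist x (g z) ≤ 9nn/4` has at most
one point of `S` within `t`.

Proof (the lead's plan). Suppose `y ≠ y'` are both within `t` of `c := g z`. The cluster
`K := B̄(c, t) ∩ S` is finite (`finite_inter_of_separated`); let `p ∈ K` be farthest from `c`.
A second point of `K` shows that the scale `a := Metric.infDist p (S \ {p})` of `p` satisfies
`0 < a ≤ 2t`. SLP-goodness at `p` (precision `7a/40`, radius `29a/10`) gives a pattern site `z'`
with `dist p (A z') ≤ 7a/40`; the angular covering hypothesis (statement of the neighbouring stub
`stub_barlowShellSupport`, our first binder) applied in the direction `A⁻¹ (p - c)` gives a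
touching site `z''` with `⟪A z'' - A z', p - c⟫ ≥ (9/20) a ‖p - c‖`, and the second matching clause
at `p` gives `q ∈ S` within `7a/40` of `A z''`. Then `0 < dist q p ≤ 27a/20` and
`⟪q - p, p - c⟫ ≥ 0`, so `dist q c > dist p c`: `q ∉ K`, i.e. `dist q c > t`. But
`dist x q ≤ 9nn/4 + 27a/20 + t ≤ 29nn/10 ≤ r`, so the first matching clause at `x` puts `q`
within `t` of some `g z₂`, `z₂ ≠ z`, whence (ideal packing, `le_dist_of_mem_barlowStacking_ideal`)
`nn ≤ dist (g z₂) (g z) ≤ t + dist q c ≤ 2t + 27a/20 ≤ (47/10) t ≤ (329/400) nn < nn`,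
a contradiction. [folklore]
-/

noncomputable section

namespace Summit.AtomisticToContinuum.Crystallization.Theorems.PricedHcpWindowsSingleOccupancy

open Literature.MathematicalPhysics.StatisticalMechanics

/-- If `p ≠ q` and `q - p` makes a non-obtuse angle with `p - c`, then `q` is strictly farther
from `c` than `p` (`‖(q - p) + (p - c)‖² = ‖q - p‖² + 2⟪q - p, p - c⟫ + ‖p - c‖²`). [folklore] -/
theorem dist_lt_dist_of_inner_nonneg {p q c : EuclideanSpace ℝ (Fin 3)} (hpq : p ≠ q)
    (hinner : 0 ≤ inner ℝ (q - p) (p - c)) : dist p c < dist q c := by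
  have hpos : 0 < ‖q - p‖ := norm_pos_iff.2 (sub_ne_zero.2 hpq.symm)
  have hsplit : q - c = (q - p) + (p - c) := by abel
  have hsq : dist q c ^ 2 = ‖q - p‖ ^ 2 + 2 * inner ℝ (q - p) (p - c) + dist p c ^ 2 := by
    rw [dist_eq_norm, dist_eq_norm, hsplit, norm_add_sq_real]
  have hlt : dist p c ^ 2 < dist q c ^ 2 := by
    rw [hsq]
    nlinarith
  exact lt_of_pow_lt_pow_left₀ 2 dist_nonneg hlt

/-- In a `δ`-separated set (`δ > 0`) the nearest-neighbour distance `Metric.infDist p (S \ {p})`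
of a point `p ∈ S` having another point `q ∈ S` is positive and at most `dist p q`. [folklore] -/
theorem infDist_pos_and_le {S : Set (EuclideanSpace ℝ (Fin 3))} {δ : ℝ} (hδ : 0 < δ)
    (hS : ∀ x ∈ S, ∀ y ∈ S, x ≠ y → δ ≤ dist x y) {p q : EuclideanSpace ℝ (Fin 3)}
    (hp : p ∈ S) (hq : q ∈ S) (hqp : q ≠ p) :
    0 < Metric.infDist p (S \ {p}) ∧ Metric.infDist p (S \ {p}) ≤ dist p q := by
  have hq' : q ∈ S \ {p} := ⟨hq, fun h => hqp (Set.mem_singleton_iff.1 h)⟩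
  refine ⟨?_, Metric.infDist_le_dist_of_mem hq'⟩
  by_contra hle
  push Not at hle
  obtain ⟨w, hw, hdist⟩ := (Metric.infDist_lt_iff ⟨q, hq'⟩).1 (hle.trans_lt hδ)
  have hsep := hS p hp w hw.1 fun h => hw.2 (Set.mem_singleton_iff.2 h.symm)
  linarith

/-- **The outward point.** Let `A` be a rigid motion, `z'` a site of the ideal Barlow stacking of
scale `a > 0` with `dist p (A z') ≤ 7a/40`, and suppose every moved site within `29a/10` of `p`
has a point of `S` within `7a/40` (second matching clause at `p`). Given the angular covering of
the touching shells (first binder of `stub_singleOccupancy`), for every direction `e` there is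
`q ∈ S` with `0 < dist q p ≤ 27a/20` and `⟪q - p, e⟫ ≥ 0`: take the touching site `z''` of `z'`
supporting the direction `A⁻¹ e` and a point `q` of `S` near `A z''`. [folklore] -/
theorem exists_outward_point
    (hL0 : ∀ a : ℝ, 0 < a → ∀ s : ℤ → ℤ, IsHaggSeq s →
      ∀ z' ∈ barlowStacking a (a * Real.sqrt (2 / 3)) s, ∀ e : EuclideanSpace ℝ (Fin 3),
        ∃ z'' ∈ barlowStacking a (a * Real.sqrt (2 / 3)) s,
          dist z' z'' = a ∧ 9 / 20 * a * ‖e‖ ≤ inner ℝ (z'' - z') e)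
    {S : Set (EuclideanSpace ℝ (Fin 3))} {a : ℝ} (ha : 0 < a) {s : ℤ → ℤ} (hs : IsHaggSeq s)
    (A : EuclideanSpace ℝ (Fin 3) ≃ᵃⁱ[ℝ] EuclideanSpace ℝ (Fin 3))
    {p z' : EuclideanSpace ℝ (Fin 3)} (hz' : z' ∈ barlowStacking a (a * Real.sqrt (2 / 3)) s)
    (hpz' : dist p (A z') ≤ 7 / 40 * a)
    (hCL2 : ∀ z ∈ barlowStacking a (a * Real.sqrt (2 / 3)) s, dist p (A z) ≤ 29 / 10 * a →
      ∃ y ∈ S, dist y (A z) ≤ 7 / 40 * a)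
    (e : EuclideanSpace ℝ (Fin 3)) :
    ∃ q ∈ S, 0 < dist q p ∧ dist q p ≤ 27 / 20 * a ∧ 0 ≤ inner ℝ (q - p) e := by
  obtain ⟨z'', hz'', hdist, hinner⟩ := hL0 a ha s hs z' hz' (A.linearIsometryEquiv.symm e)
  -- transport the angular inequality through the rigid motion `A`
  rw [LinearIsometryEquiv.norm_map] at hinner
  have hvec : A z'' - A z' = A.linearIsometryEquiv (z'' - z') := by
    have h := A.map_vsub z'' z'
    simp only [vsub_eq_sub] at h
    exact h.symm
  have hinner' : inner ℝ (A z'' - A z') e = inner ℝ (z'' - z') (A.linearIsometryEquiv.symm e) := by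
    rw [hvec, LinearIsometryEquiv.inner_map_eq_flip]
  have hAd : dist (A z'') (A z') = a := by rw [A.dist_map, dist_comm, hdist]
  -- the second matching clause at `p` applies to `z''`
  have hpz'' : dist p (A z'') ≤ 29 / 10 * a := by
    have h := dist_triangle p (A z') (A z'')
    rw [dist_comm (A z') (A z''), hAd] at h
    linarith
  obtain ⟨q, hqS, hqz''⟩ := hCL2 z'' hz'' hpz''
  have hpz'₂ : dist (A z') p ≤ 7 / 40 * a := by rwa [dist_comm] at hpz'
  refine ⟨q, hqS, ?_, ?_, ?_⟩
  · have h := dist_triangle4 (A z'') q p (A z')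
    rw [hAd, dist_comm (A z'') q, dist_comm p (A z')] at h
    linarith
  · have h := dist_triangle4 q (A z'') (A z') p
    rw [hAd] at h
    linarith
  · have hsplit : q - p = (q - A z'') + (A z'' - A z') + (A z' - p) := by abel
    rw [hsplit, inner_add_left, inner_add_left, hinner']
    have h1 : |inner ℝ (q - A z'') e| ≤ ‖q - A z''‖ * ‖e‖ := abs_real_inner_le_norm _ _
    have h2 : |inner ℝ (A z' - p) e| ≤ ‖A z' - p‖ * ‖e‖ := abs_real_inner_le_norm _ _
    rw [← dist_eq_norm] at h1 h2
    have he : 0 ≤ ‖e‖ := norm_nonneg e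
    have h1' := (abs_le.1 h1).1
    have h2' := (abs_le.1 h2).1
    have h3 := mul_le_mul_of_nonneg_right hqz'' he
    have h4 := mul_le_mul_of_nonneg_right hpz'₂ he
    have h5 : 0 ≤ a * ‖e‖ := mul_nonneg ha.le he
    linarith

/-- **NO MICRO-CLUSTERS (single occupancy of pattern sites).** In a `δ`-separated set
`S ⊆ ℝ³` all of whose points are SLP-good and bond-shell-good, for a point `x ∈ S` with scale
`nn = Metric.infDist x (S \ {x})`, a precision `t ∈ (nn/6, 7nn/40]`, a radius `r ≥ 29nn/10` and
matching data `(s, g)` satisfying the two matching clauses at `x`, every pattern point `g z` with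
`dist x (g z) ≤ 9nn/4` has at most one point of `S` within `t`. The first binder is the angular
covering of the Barlow touching shells (stub `stub_barlowShellSupport`). [folklore] -/
theorem stub_singleOccupancy :
    (∀ a : ℝ, 0 < a → ∀ s : ℤ → ℤ, Literature.MathematicalPhysics.StatisticalMechanics.IsHaggSeq s →
    ∀ z' ∈ Literature.MathematicalPhysics.StatisticalMechanics.barlowStacking a (a * Real.sqrt (2 /
    3)) s, ∀ e : EuclideanSpace ℝ (Fin 3), ∃ z'' ∈
    Literature.MathematicalPhysics.StatisticalMechanics.barlowStacking a (a * Real.sqrt (2 / 3)) s,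
    dist z' z'' = a ∧ 9 / 20 * a * ‖e‖ ≤ inner ℝ (z'' - z') e) → ∀ δ : ℝ, 0 < δ → ∀ S : Set
    (EuclideanSpace ℝ (Fin 3)), (∀ x ∈ S, ∀ y ∈ S, x ≠ y → δ ≤ dist x y) → (∀ x ∈ S, (∀ t r : ℝ,
    Metric.infDist x (S \ {x}) / 6 < t → r < 3 * Metric.infDist x (S \ {x}) → ∃ s : ℤ → ℤ,
    Literature.MathematicalPhysics.StatisticalMechanics.IsHaggSeq s ∧ ∃ g : EuclideanSpace ℝ (Fin 3)
    ≃ᵃⁱ[ℝ] EuclideanSpace ℝ (Fin 3), (∀ y ∈ S, dist x y ≤ r → ∃ z ∈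
    Literature.MathematicalPhysics.StatisticalMechanics.barlowStacking (Metric.infDist x (S \ {x}))
    (Metric.infDist x (S \ {x}) * Real.sqrt (2 / 3)) s, dist y (g z) ≤ t) ∧ (∀ z ∈
    Literature.MathematicalPhysics.StatisticalMechanics.barlowStacking (Metric.infDist x (S \ {x}))
    (Metric.infDist x (S \ {x}) * Real.sqrt (2 / 3)) s, dist x (g z) ≤ r → ∃ y ∈ S, dist y (g z) ≤
    t)) ∧ ((∀ y ∈ S, y ≠ x → dist x y < 107 / 100 * Metric.infDist x (S \ {x}) → dist x y ≤ 101 /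
    100 * Metric.infDist x (S \ {x})) ∧ ∃ T : Finset (EuclideanSpace ℝ (Fin 3)), (↑T : Set
    (EuclideanSpace ℝ (Fin 3))) ⊆ {y : EuclideanSpace ℝ (Fin 3) | y ∈ S ∧ y ≠ x ∧ dist x y ≤ 101 /
    100 * Metric.infDist x (S \ {x})} ∧ T.card = 12)) → ∀ x ∈ S, ∀ t r : ℝ, Metric.infDist x (S \
    {x}) / 6 < t → t ≤ 7 / 40 * Metric.infDist x (S \ {x}) → 29 / 10 * Metric.infDist x (S \ {x}) ≤
    r → ∀ (s : ℤ → ℤ) (g : EuclideanSpace ℝ (Fin 3) ≃ᵃⁱ[ℝ] EuclideanSpace ℝ (Fin 3)),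
    Literature.MathematicalPhysics.StatisticalMechanics.IsHaggSeq s → (∀ y ∈ S, dist x y ≤ r → ∃ z ∈
    Literature.MathematicalPhysics.StatisticalMechanics.barlowStacking (Metric.infDist x (S \ {x}))
    (Metric.infDist x (S \ {x}) * Real.sqrt (2 / 3)) s, dist y (g z) ≤ t) → (∀ z ∈
    Literature.MathematicalPhysics.StatisticalMechanics.barlowStacking (Metric.infDist x (S \ {x}))
    (Metric.infDist x (S \ {x}) * Real.sqrt (2 / 3)) s, dist x (g z) ≤ r → ∃ y ∈ S, dist y (g z) ≤
    t) → ∀ z ∈ Literature.MathematicalPhysics.StatisticalMechanics.barlowStacking (Metric.infDist x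
    (S \ {x})) (Metric.infDist x (S \ {x}) * Real.sqrt (2 / 3)) s, dist x (g z) ≤ 9 / 4 *
    Metric.infDist x (S \ {x}) → ∀ y ∈ S, ∀ y' ∈ S, dist y (g z) ≤ t → dist y' (g z) ≤ t →
    y = y' := by
  intro hL0 δ hδ S hsep hgood x _hx t r ht1 ht2 hr s g hs hCL1 _hCL2 z hz hxz y hy y' hy' hyz hy'z
  by_contra hne
  -- the scale of `x` is positive (the precision window is nonempty)
  have hnn0 : 0 ≤ Metric.infDist x (S \ {x}) := Metric.infDist_nonneg
  have hnn : 0 < Metric.infDist x (S \ {x}) := by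
    rcases hnn0.eq_or_lt with h | h
    · rw [← h] at ht1 ht2
      linarith
    · exact h
  -- the finite cluster `K = B̄(g z, t) ∩ S` and its farthest point `p`
  have hKfin : (Metric.closedBall (g z) t ∩ S).Finite :=
    Literature.Probability.Process.LocalConfig.finite_inter_of_separated hδ hsep
      (isCompact_closedBall (g z) t)
  have hyK : y ∈ Metric.closedBall (g z) t ∩ S := ⟨Metric.mem_closedBall.2 hyz, hy⟩
  have hy'K : y' ∈ Metric.closedBall (g z) t ∩ S := ⟨Metric.mem_closedBall.2 hy'z, hy'⟩
  obtain ⟨p, hpK, hpmax⟩ :=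
    (Metric.closedBall (g z) t ∩ S).exists_max_image (fun w => dist w (g z)) hKfin ⟨y, hyK⟩
  have hpS : p ∈ S := hpK.2
  have hpc : dist p (g z) ≤ t := Metric.mem_closedBall.1 hpK.1
  -- a second point of the cluster bounds the scale `a` of `p`: `0 < a ≤ 2t`
  obtain ⟨q₀, hq₀K, hq₀p⟩ : ∃ q₀ ∈ Metric.closedBall (g z) t ∩ S, q₀ ≠ p := by
    by_cases hyp : y = p
    · exact ⟨y', hy'K, fun h => hne (hyp.trans h.symm)⟩
    · exact ⟨y, hyK, hyp⟩
  obtain ⟨ha, hale⟩ := infDist_pos_and_le hδ hsep hpS hq₀K.2 hq₀p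
  have hq₀c : dist q₀ (g z) ≤ t := Metric.mem_closedBall.1 hq₀K.1
  have ha2t : Metric.infDist p (S \ {p}) ≤ 2 * t := by
    have h := dist_triangle p (g z) q₀
    rw [dist_comm (g z) q₀] at h
    linarith
  -- SLP-goodness at `p` with precision `7a/40` and radius `29a/10`
  obtain ⟨sp, hsp, A, hCL1p, hCL2p⟩ := (hgood p hpS).1 (7 / 40 * Metric.infDist p (S \ {p}))
    (29 / 10 * Metric.infDist p (S \ {p})) (by linarith) (by linarith)
  obtain ⟨z', hz', hpz'⟩ := hCL1p p hpS (by rw [dist_self]; linarith)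
  -- the outward point `q`
  obtain ⟨q, hqS, hqp0, hqp, hinner⟩ :=
    exists_outward_point hL0 ha hsp A hz' hpz' hCL2p (p - g z)
  have hfar : dist p (g z) < dist q (g z) :=
    dist_lt_dist_of_inner_nonneg (dist_pos.1 hqp0).symm hinner
  -- `q ∉ K`, i.e. `dist q (g z) > t`
  have hqc : t < dist q (g z) := by
    by_contra hle
    push Not at hle
    have h := hpmax q ⟨Metric.mem_closedBall.2 hle, hqS⟩
    linarith
  have hqc' : dist q (g z) ≤ 27 / 20 * Metric.infDist p (S \ {p}) + t := by
    have h := dist_triangle q p (g z)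
    linarith
  -- `q` is within `r` of `x`, so it is matched to a site `z₂ ≠ z` of the pattern of `x`
  have hxq : dist x q ≤ r := by
    have h := dist_triangle x (g z) q
    rw [dist_comm (g z) q] at h
    linarith
  obtain ⟨z₂, hz₂, hqz₂⟩ := hCL1 q hqS hxq
  have hz₂z : z₂ ≠ z := by
    intro h
    rw [h] at hqz₂
    linarith
  have hh : (Metric.infDist x (S \ {x}) * Real.sqrt (2 / 3)) ^ 2 =
      2 / 3 * Metric.infDist x (S \ {x}) ^ 2 := by
    rw [mul_pow, Real.sq_sqrt (by norm_num : (0 : ℝ) ≤ 2 / 3)]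
    ring
  have hzz : Metric.infDist x (S \ {x}) ≤ dist z₂ z :=
    le_dist_of_mem_barlowStacking_ideal hs hnn hh hz₂ hz hz₂z
  rw [← g.dist_map] at hzz
  have htri := dist_triangle (g z₂) q (g z)
  rw [dist_comm (g z₂) q] at htri
  linarith

end Summit.AtomisticToContinuum.Crystallization.Theorems.PricedHcpWindowsSingleOccupancy

end
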